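import Summits.QuantumFields.YangMills.Theorems.ColdStartUniversalityLatticeLangevinWilsonSemigroupConvexity
import HarnessLib

/-!
# Route `ColdStartUniversality` (fixed-cut-off `L²(μ_{β'})` package): POINCARÉ INEQUALITY FOR THE SEMIGROUP DIRICHLET FORM
# ⇔ EXPONENTIAL `L²` DECAY, WITH THE SAME CONSTANT — no generator, no core, no heat equation

Helper file (seat `ym-line-csu-p1`, g17; `--supports stmt-QuantumFields-27363`).  For the SU(2) lattice Langevin dynamics of
Shen–Zhu–Zhu at any torus size `L` and coupling `β'`, reversible with respect to the Wilson measure `μ = μ_{β'}`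
(`integral_mul_transition_symm_su2`), write, for a continuous observable `G` and a lattice time `h > 0`,

  `𝓔_h(G) := h⁻¹ (∫ G² dμ − ∫ G · κ_h G dμ) = (2h)⁻¹ ∬ (G(x) − G(y))² κ_h(x,dy) μ(dx)`

— the DIRICHLET FORM OF THE SEMIGROUP AT SCALE `h` (it increases as `h ↓ 0`, `dirichletScale_antitone`; on smooth cylinder functions
its limit is `−∫ G 𝓛G dμ`, `tendsto_dirichletForm_semigroup`).  The g16 file `…ChiSquarePoincare` had to take the classical
equivalence «Poincaré inequality with constant `1/λ` ⇔ `Var_μ(κ_t G) ≤ e^{−2λt} Var_μ(G)`» (Bakry–Gentil–Ledoux Thm 4.2.5) as a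
HYPOTHESIS `hEquiv`, because its textbook proof differentiates `t ↦ Var(P_t f)` through the generator on a core.  This file proves
the equivalence for the SZZ kernels WITHOUT any generator theory, for the Poincaré inequality stated on the semigroup Dirichlet
form (the form in which Bakry–Gentil–Ledoux's Remark 4.3.3 restates `P(C)`):

* ★★ `integral_sq_transition_sub_le_exp_of_semigroupPoincare` — if every continuous `G` satisfies, for every `η > 0`,
  `(λ − η) Var_μ(G) ≤ 𝓔_h(G)` for SOME `h > 0` (the Poincaré inequality for `𝓔 = sup_h 𝓔_h`, constant `1/λ`), then
  `∫ (κ_t G − μG)² dμ ≤ e^{−2λt} Var_μ(G)` for every continuous `G` and every `t` (the convex `Φ(u) = ∫ G₀ κ_u G₀ dμ`, `G₀ = G − μG`,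
  has forward slope `−𝓔_h(κ_{b/2} G₀)` at `b`, and `Var(κ_{b/2} G₀) = Φ(b)`; discrete Grönwall `le_exp_neg_mul_of_convexOn_of_forall_step`).
* ★ `semigroupPoincare_of_integral_sq_transition_sub_le_exp` — conversely the decay gives `(1 − e^{−λh})/h · Var_μ(G) ≤ 𝓔_h(G)` for
  EVERY `h > 0` (Bakry–Gentil–Ledoux Remark 4.3.3).
* ★ `semigroupPoincare_iff_integral_sq_transition_sub_le_exp` — at fixed cut-off THE BEST POINCARÉ CONSTANT OF THE SEMIGROUP
  DIRICHLET FORM ON `C(X)` IS THE `L²(μ)` DECAY RATE (both directions; `(1 − e^{−λh})/h → λ`).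
* `wilson_semigroupPoincare` — the inequality holds at every `L, β'` with the Doeblin rate `c(L, β')` of `wilson_spectralGap`.

So the only fixed-cut-off content left in `hEquiv` is the passage from the GENERATOR form of the Poincaré inequality on `C³`
cylinder functions to the SEMIGROUP form on `C(X)` (essential self-adjointness / hypoelliptic smoothing of `κ_s`) — isolated in the
sequel `…WilsonSemigroupPoincareSmoothing`.  THEOREMS ONLY, no definition, no sorry.  HONEST FRAMING: RECORD-rung R3 plumbing at
FIXED cut-off; nothing K-uniform is proved; no crux, rung or summit statement is proved; the Yang–Mills mass gap is NOT proved.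
-/

set_option autoImplicit false

noncomputable section

namespace Summit.QuantumFields.YangMills.Theorems.ColdStartUniversality

open MeasureTheory ProbabilityTheory Filter Set Topology
open scoped BigOperators NNReal ENNReal
open Literature.Probability.Process Literature.MathematicalPhysics.QuantumFieldTheory
open Literature.MathematicalPhysics.QuantumLattice (fundamentalRep fundamentalLatticeRep continuous_fundamentalRep)

/-! ## §3. Poincaré inequality for the semigroup Dirichlet form ⇔ exponential `L²(μ_{β'})` decay -/

/-- ★★ **Poincaré ⇒ decay, same constant, no core.**  If every continuous observable `G` satisfies the Poincaré inequality for
the Dirichlet form of the SZZ semigroup with constant `1/λ` — in the finitary form «for every `η > 0` there is a scale `h > 0` with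
`(λ − η) Var_μ(G) ≤ h⁻¹(∫ G² dμ − ∫ G κ_h G dμ)`» — then for every continuous `G` and every lattice time `t`,
`∫ (κ_t G − μG)² dμ_{β'} ≤ e^{−2λt} Var_{μ_{β'}}(G)`.  Proof: `Φ(u) = ∫ G₀ κ_u G₀ dμ` (`G₀ = G − μG`) is convex
(`convexOn_integral_mul_transition`), its forward secant slope at `b` over `[b, b+h]` is `−𝓔_h(κ_{b/2} G₀)` (Chapman–Kolmogorov +
reversibility) with `Var(κ_{b/2}G₀) = Φ(b)` (invariance), so the hypothesis at `κ_{b/2} G₀` feeds the discrete Grönwall lemma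
`le_exp_neg_mul_of_convexOn_of_forall_step`; finally `η → 0`. [cite: BakryGentilLedoux2014, Thm 4.2.5 (i)⇒(ii) with Remark 4.3.3] -/
theorem integral_sq_transition_sub_le_exp_of_semigroupPoincare (L : ℕ) [NeZero L] (β' : ℝ)
    (κ : ℝ≥0 → Kernel (GaugeConfig 3 L (Matrix.specialUnitaryGroup (Fin 2) ℂ))
      (GaugeConfig 3 L (Matrix.specialUnitaryGroup (Fin 2) ℂ))) [∀ t, IsMarkovKernel (κ t)]
    (hreal : ∀ (t : ℝ≥0) (x : GaugeConfig 3 L (Matrix.specialUnitaryGroup (Fin 2) ℂ))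
        (Ω : Type) [MeasurableSpace Ω] (P : Measure Ω) [IsProbabilityMeasure P]
        (W : ℝ≥0 → Ω → (Edge 3 L × NoiseIdx 2 → ℝ)) (hW : IsFlatBrownian W P)
        (U : ℝ≥0 → Ω → GaugeConfig 3 L (Matrix.specialUnitaryGroup (Fin 2) ℂ)),
        (∀ ω, U 0 ω = x) →
        (latticeLangevinDynamics (fundamentalLatticeRep 2) β').IsSolution (fundamentalRep (Fin 2))
          hW.natFiltration P W U →
        κ t x = P.map (U t))
    {lam : ℝ}
    (hP : ∀ G : GaugeConfig 3 L (Matrix.specialUnitaryGroup (Fin 2) ℂ) → ℝ, Continuous G → ∀ η : ℝ, 0 < η →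
      ∃ h : ℝ≥0, 0 < h ∧
        (lam - η) * ∫ x, (G x - ∫ z, G z ∂(wilsonMeasure (d := 3) (L := L) (fundamentalRep (Fin 2)) β')) ^ 2
            ∂(wilsonMeasure (d := 3) (L := L) (fundamentalRep (Fin 2)) β') ≤
          (h : ℝ)⁻¹ * ((∫ x, G x * G x ∂(wilsonMeasure (d := 3) (L := L) (fundamentalRep (Fin 2)) β')) -
            ∫ x, G x * (∫ y, G y ∂(κ h x)) ∂(wilsonMeasure (d := 3) (L := L) (fundamentalRep (Fin 2)) β')))
    {G : GaugeConfig 3 L (Matrix.specialUnitaryGroup (Fin 2) ℂ) → ℝ} (hG : Continuous G) (t : ℝ≥0) :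
    ∫ x, ((∫ y, G y ∂(κ t x)) - ∫ z, G z ∂(wilsonMeasure (d := 3) (L := L) (fundamentalRep (Fin 2)) β')) ^ 2
        ∂(wilsonMeasure (d := 3) (L := L) (fundamentalRep (Fin 2)) β') ≤
      Real.exp (-2 * lam * t) *
        ∫ x, (G x - ∫ z, G z ∂(wilsonMeasure (d := 3) (L := L) (fundamentalRep (Fin 2)) β')) ^ 2
          ∂(wilsonMeasure (d := 3) (L := L) (fundamentalRep (Fin 2)) β') := by
  classical
  haveI := secondCountableTopology_su2
  haveI := borelSpace_config L
  set μ : Measure (GaugeConfig 3 L (Matrix.specialUnitaryGroup (Fin 2) ℂ)) :=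
    wilsonMeasure (d := 3) (L := L) (fundamentalRep (Fin 2)) β' with hμ
  haveI : IsProbabilityMeasure μ :=
    isProbabilityMeasure_wilsonMeasure (d := 3) (L := L) (fundamentalRep (Fin 2)) (continuous_fundamentalRep (Fin 2)) β'
  -- the centred observable
  set m : ℝ := ∫ z, G z ∂μ with hm
  set G₀ : GaugeConfig 3 L (Matrix.specialUnitaryGroup (Fin 2) ℂ) → ℝ := fun x => G x - m with hG₀
  have hG₀c : Continuous G₀ := hG.sub continuous_const
  obtain ⟨M, hM0, hM⟩ := exists_abs_le_of_continuous hG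
  obtain ⟨M₀, hM₀0, hM₀⟩ := exists_abs_le_of_continuous hG₀c
  have hGi : ∀ (ν : Measure (GaugeConfig 3 L (Matrix.specialUnitaryGroup (Fin 2) ℂ))) [IsProbabilityMeasure ν],
      Integrable G ν := fun ν _ =>
    Integrable.of_bound hG.aestronglyMeasurable M (Eventually.of_forall fun z => by rw [Real.norm_eq_abs]; exact hM z)
  have hG₀i : ∀ (ν : Measure (GaugeConfig 3 L (Matrix.specialUnitaryGroup (Fin 2) ℂ))) [IsProbabilityMeasure ν],
      Integrable G₀ ν := fun ν _ =>
    Integrable.of_bound hG₀c.aestronglyMeasurable M₀ (Eventually.of_forall fun z => by rw [Real.norm_eq_abs]; exact hM₀ z)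
  -- `κ_u G₀ = κ_u G − m` and `∫ G₀ dμ = 0`, `∫ κ_u G₀ dμ = 0`
  have hκG₀ : ∀ (u : ℝ≥0) x, ∫ y, G₀ y ∂(κ u x) = (∫ y, G y ∂(κ u x)) - m := by
    intro u x
    simp only [hG₀]
    rw [integral_sub (hGi _) (integrable_const m), integral_const, probReal_univ, one_smul]
  have hG₀0 : ∫ x, G₀ x ∂μ = 0 := by
    simp only [hG₀]
    rw [integral_sub (hGi _) (integrable_const m), integral_const, probReal_univ, one_smul, hm, sub_self]
  have hκG₀0 : ∀ u : ℝ≥0, ∫ x, (∫ y, G₀ y ∂(κ u x)) ∂μ = 0 := by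
    intro u
    rw [integral_transitionKernel_integral_eq_wilson (L := L) β' κ hreal u hG₀c.measurable ⟨M₀, hM₀⟩]
    exact hG₀0
  -- the convex function `Φ`
  set Φ : ℝ → ℝ := fun u => ∫ x, G₀ x * (∫ y, G₀ y ∂(κ u.toNNReal x)) ∂μ with hΦ
  have hconv : ConvexOn ℝ (Ici (0 : ℝ)) Φ := convexOn_integral_mul_transition L β' κ hreal hG₀c
  -- `Φ 0 = Var(G)` and `Φ (2t) = ∫ (κ_t G − m)²`
  have hκ0 : κ 0 = Kernel.id := transitionKernel_zero_eq_id L β' κ hreal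
  have hΦ0 : Φ 0 = ∫ x, (G x - m) ^ 2 ∂μ := by
    simp only [hΦ, Real.toNNReal_zero, hκ0, Kernel.id_apply, integral_dirac]
    exact integral_congr_ae (Eventually.of_forall fun x => by simp only [hG₀]; ring)
  have hΦ2t : Φ ((t : ℝ) + t) = ∫ x, ((∫ y, G y ∂(κ t x)) - m) ^ 2 ∂μ := by
    have e : ((t : ℝ) + t).toNNReal = t + t := by rw [← NNReal.coe_add, Real.toNNReal_coe]
    simp only [hΦ, e]
    rw [integral_mul_transition_self_eq_sq L β' κ hreal t hG₀c]
    exact integral_congr_ae (Eventually.of_forall fun x => by simp only [hκG₀ t x])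
  -- the forward-slope hypothesis of the discrete Grönwall lemma, for every `η ∈ (0, λ)`
  have hstep : ∀ η : ℝ, 0 < η → ∀ b : ℝ, 0 ≤ b → ∃ h : ℝ, 0 < h ∧ (lam - η) * Φ b ≤ (Φ b - Φ (b + h)) / h := by
    intro η hη b hb
    set s : ℝ≥0 := (b / 2).toNNReal with hs
    -- the continuous observable `H = κ_s G₀`
    set H : GaugeConfig 3 L (Matrix.specialUnitaryGroup (Fin 2) ℂ) → ℝ := fun x => ∫ y, G₀ y ∂(κ s x) with hH
    have hHc : Continuous H := continuous_integral_transitionKernel L β' κ hreal s hG₀c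
    obtain ⟨h, hh, hPH⟩ := hP H hHc η hη
    have hhR : (0 : ℝ) < h := by exact_mod_cast hh
    refine ⟨h, hhR, ?_⟩
    -- `∫ H dμ = 0`, so `Var(H) = ∫ H² = Φ b`
    have hH0 : ∫ z, H z ∂μ = 0 := hκG₀0 s
    have hss : ((s : ℝ) + s) = b := by
      rw [hs, Real.coe_toNNReal _ (by linarith)]; ring
    have hVarH : ∫ x, (H x - ∫ z, H z ∂μ) ^ 2 ∂μ = Φ b := by
      rw [hH0]
      have e : ((s : ℝ) + s).toNNReal = s + s := by rw [← NNReal.coe_add, Real.toNNReal_coe]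
      rw [← hss]
      simp only [hΦ, e, sub_zero]
      rw [integral_mul_transition_self_eq_sq L β' κ hreal s hG₀c]
    have hHH : ∫ x, H x * H x ∂μ = Φ b := by
      rw [← hVarH, hH0]
      exact integral_congr_ae (Eventually.of_forall fun x => by simp only [sub_zero]; ring)
    -- `∫ H κ_h H dμ = Φ (b + h)`
    have hCK : κ (h + s) = κ s ∘ₖ κ h := chapmanKolmogorov_szz β' κ hreal h s
    have e1 : ∀ x, ∫ y, H y ∂(κ h x) = ∫ y, G₀ y ∂(κ (h + s) x) := by
      intro x
      haveI : IsProbabilityMeasure ((κ s ∘ₖ κ h) x) := by rw [← hCK]; infer_instance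
      simp only [hH]
      rw [hCK]
      exact (Kernel.integral_comp (hG₀i _)).symm
    have hHκH : ∫ x, H x * (∫ y, H y ∂(κ h x)) ∂μ = Φ (b + h) := by
      have e : (b + (h : ℝ)).toNNReal = s + (h + s) := by
        rw [← hss, show (s : ℝ) + s + h = ((s + (h + s) : ℝ≥0) : ℝ) by push_cast; ring, Real.toNNReal_coe]
      simp only [hΦ, e]
      simp_rw [e1]
      exact integral_transition_mul_transition_eq L β' κ hreal s (h + s) hG₀c
    rw [hVarH, hHH, hHκH] at hPH
    rw [div_eq_inv_mul]
    exact hPH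
  -- conclude: `Φ (2t) ≤ e^{−2(λ−η)t} Φ 0` for every `η ∈ (0, λ)`, then `η → 0`
  have h2t : (0 : ℝ) ≤ (t : ℝ) + t := by positivity
  have hmain : ∀ η : ℝ, 0 < η → η < lam → Φ ((t : ℝ) + t) ≤ Real.exp (-((lam - η) * ((t : ℝ) + t))) * Φ 0 :=
    fun η hη hηl => le_exp_neg_mul_of_convexOn_of_forall_step hconv (by linarith) (hstep η hη) h2t
  have hΦ0nn : 0 ≤ Φ 0 := by rw [hΦ0]; exact integral_nonneg fun x => sq_nonneg _
  show ∫ x, ((∫ y, G y ∂(κ t x)) - m) ^ 2 ∂μ ≤ Real.exp (-2 * lam * t) * ∫ x, (G x - m) ^ 2 ∂μ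
  rw [← hΦ0, ← hΦ2t]
  rcases le_or_gt lam 0 with hlam | hlam
  · -- `λ ≤ 0`: the bound follows from `Φ (2t) ≤ Φ 0` (antitonicity) and `e^{−2λt} ≥ 1`
    have hanti : Φ ((t : ℝ) + t) ≤ Φ 0 := by
      have e : ((t : ℝ) + t).toNNReal = t + t := by rw [← NNReal.coe_add, Real.toNNReal_coe]
      simp only [hΦ, e, Real.toNNReal_zero]
      have ha := integral_mul_transition_self_antitone L β' κ hreal 0 (t + t) hG₀c
      rw [zero_add] at ha
      exact ha
    have hexp : 1 ≤ Real.exp (-2 * lam * t) := Real.one_le_exp (by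
      have : (0 : ℝ) ≤ t := t.2
      nlinarith)
    calc Φ ((t : ℝ) + t) ≤ Φ 0 := hanti
      _ = 1 * Φ 0 := (one_mul _).symm
      _ ≤ Real.exp (-2 * lam * t) * Φ 0 := mul_le_mul_of_nonneg_right hexp hΦ0nn
  · -- `λ > 0`: let `η → 0⁺`
    have hlimf : Tendsto (fun η : ℝ => Real.exp (-((lam - η) * ((t : ℝ) + t))) * Φ 0) (𝓝[>] 0)
        (𝓝 (Real.exp (-((lam - 0) * ((t : ℝ) + t))) * Φ 0)) := by
      have hc : Continuous fun η : ℝ => Real.exp (-((lam - η) * ((t : ℝ) + t))) * Φ 0 := by fun_prop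
      exact (hc.tendsto 0).mono_left nhdsWithin_le_nhds
    have hev : ∀ᶠ η : ℝ in 𝓝[>] 0, Φ ((t : ℝ) + t) ≤ Real.exp (-((lam - η) * ((t : ℝ) + t))) * Φ 0 := by
      have h1 : ∀ᶠ η : ℝ in 𝓝[>] 0, η < lam :=
        (eventually_lt_nhds hlam).filter_mono nhdsWithin_le_nhds
      filter_upwards [h1, self_mem_nhdsWithin] with η hηl hη
      exact hmain η hη hηl
    have hle := ge_of_tendsto hlimf hev
    have e : Real.exp (-((lam - 0) * ((t : ℝ) + t))) = Real.exp (-2 * lam * t) := by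
      congr 1; ring
    rw [e] at hle
    exact hle

/-- ★ **Decay ⇒ Poincaré for the semigroup Dirichlet form at EVERY scale** (Bakry–Gentil–Ledoux Remark 4.3.3): if
`∫ (κ_t G − μG)² dμ ≤ e^{−2λt} Var_μ(G)` for all continuous `G` and all `t`, then for every continuous `G` and every `h > 0`,
`(1 − e^{−λh})/h · Var_μ(G) ≤ h⁻¹(∫ G² dμ − ∫ G κ_h G dμ)` (indeed `∫ G² − ∫ G κ_h G = Var(G) − ‖κ_{h/2}(G − μG)‖²`).
[cite: BakryGentilLedoux2014, Remark 4.3.3 (p. 212)] -/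
theorem semigroupPoincare_of_integral_sq_transition_sub_le_exp (L : ℕ) [NeZero L] (β' : ℝ)
    (κ : ℝ≥0 → Kernel (GaugeConfig 3 L (Matrix.specialUnitaryGroup (Fin 2) ℂ))
      (GaugeConfig 3 L (Matrix.specialUnitaryGroup (Fin 2) ℂ))) [∀ t, IsMarkovKernel (κ t)]
    (hreal : ∀ (t : ℝ≥0) (x : GaugeConfig 3 L (Matrix.specialUnitaryGroup (Fin 2) ℂ))
        (Ω : Type) [MeasurableSpace Ω] (P : Measure Ω) [IsProbabilityMeasure P]
        (W : ℝ≥0 → Ω → (Edge 3 L × NoiseIdx 2 → ℝ)) (hW : IsFlatBrownian W P)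
        (U : ℝ≥0 → Ω → GaugeConfig 3 L (Matrix.specialUnitaryGroup (Fin 2) ℂ)),
        (∀ ω, U 0 ω = x) →
        (latticeLangevinDynamics (fundamentalLatticeRep 2) β').IsSolution (fundamentalRep (Fin 2))
          hW.natFiltration P W U →
        κ t x = P.map (U t))
    {lam : ℝ}
    (hdecay : ∀ G : GaugeConfig 3 L (Matrix.specialUnitaryGroup (Fin 2) ℂ) → ℝ, Continuous G → ∀ t : ℝ≥0,
      ∫ x, ((∫ y, G y ∂(κ t x)) - ∫ z, G z ∂(wilsonMeasure (d := 3) (L := L) (fundamentalRep (Fin 2)) β')) ^ 2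
          ∂(wilsonMeasure (d := 3) (L := L) (fundamentalRep (Fin 2)) β') ≤
        Real.exp (-2 * lam * t) *
          ∫ x, (G x - ∫ z, G z ∂(wilsonMeasure (d := 3) (L := L) (fundamentalRep (Fin 2)) β')) ^ 2
            ∂(wilsonMeasure (d := 3) (L := L) (fundamentalRep (Fin 2)) β'))
    {G : GaugeConfig 3 L (Matrix.specialUnitaryGroup (Fin 2) ℂ) → ℝ} (hG : Continuous G) {h : ℝ≥0} (hh : 0 < h) :
    (1 - Real.exp (-lam * h)) / h *
        ∫ x, (G x - ∫ z, G z ∂(wilsonMeasure (d := 3) (L := L) (fundamentalRep (Fin 2)) β')) ^ 2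
          ∂(wilsonMeasure (d := 3) (L := L) (fundamentalRep (Fin 2)) β') ≤
      (h : ℝ)⁻¹ * ((∫ x, G x * G x ∂(wilsonMeasure (d := 3) (L := L) (fundamentalRep (Fin 2)) β')) -
        ∫ x, G x * (∫ y, G y ∂(κ h x)) ∂(wilsonMeasure (d := 3) (L := L) (fundamentalRep (Fin 2)) β')) := by
  classical
  haveI := secondCountableTopology_su2
  haveI := borelSpace_config L
  set μ : Measure (GaugeConfig 3 L (Matrix.specialUnitaryGroup (Fin 2) ℂ)) :=
    wilsonMeasure (d := 3) (L := L) (fundamentalRep (Fin 2)) β' with hμ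
  haveI : IsProbabilityMeasure μ :=
    isProbabilityMeasure_wilsonMeasure (d := 3) (L := L) (fundamentalRep (Fin 2)) (continuous_fundamentalRep (Fin 2)) β'
  set m : ℝ := ∫ z, G z ∂μ with hm
  set G₀ : GaugeConfig 3 L (Matrix.specialUnitaryGroup (Fin 2) ℂ) → ℝ := fun x => G x - m with hG₀
  have hG₀c : Continuous G₀ := hG.sub continuous_const
  obtain ⟨M, hM0, hM⟩ := exists_abs_le_of_continuous hG
  obtain ⟨M₀, hM₀0, hM₀⟩ := exists_abs_le_of_continuous hG₀c
  have hGi : ∀ (ν : Measure (GaugeConfig 3 L (Matrix.specialUnitaryGroup (Fin 2) ℂ))) [IsProbabilityMeasure ν],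
      Integrable G ν := fun ν _ =>
    Integrable.of_bound hG.aestronglyMeasurable M (Eventually.of_forall fun z => by rw [Real.norm_eq_abs]; exact hM z)
  have hκG₀ : ∀ (u : ℝ≥0) x, ∫ y, G₀ y ∂(κ u x) = (∫ y, G y ∂(κ u x)) - m := by
    intro u x
    simp only [hG₀]
    rw [integral_sub (hGi _) (integrable_const m), integral_const, probReal_univ, one_smul]
  have hG₀0 : ∫ x, G₀ x ∂μ = 0 := by
    simp only [hG₀]
    rw [integral_sub (hGi _) (integrable_const m), integral_const, probReal_univ, one_smul, hm, sub_self]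
  have hκG₀0 : ∀ u : ℝ≥0, ∫ x, (∫ y, G₀ y ∂(κ u x)) ∂μ = 0 := by
    intro u
    rw [integral_transitionKernel_integral_eq_wilson (L := L) β' κ hreal u hG₀c.measurable ⟨M₀, hM₀⟩]
    exact hG₀0
  -- continuity / integrability of the kernel images
  have hκGc : ∀ u : ℝ≥0, Continuous fun x => ∫ y, G y ∂(κ u x) := fun u =>
    continuous_integral_transitionKernel L β' κ hreal u hG
  have hκG₀c : ∀ u : ℝ≥0, Continuous fun x => ∫ y, G₀ y ∂(κ u x) := fun u =>
    continuous_integral_transitionKernel L β' κ hreal u hG₀c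
  -- (1) `∫ G² − ∫ G κ_h G = ∫ G₀² − ∫ G₀ κ_h G₀`
  have hi1 : Integrable (fun x => G x * G x) μ := integrable_of_continuous_of_compactSpace (hG.mul hG) μ
  have hi2 : Integrable (fun x => G x * (∫ y, G y ∂(κ h x))) μ :=
    integrable_of_continuous_of_compactSpace (hG.mul (hκGc h)) μ
  have hi3 : Integrable (fun x => G₀ x * G₀ x) μ := integrable_of_continuous_of_compactSpace (hG₀c.mul hG₀c) μ
  have hi4 : Integrable (fun x => G₀ x * (∫ y, G₀ y ∂(κ h x))) μ :=
    integrable_of_continuous_of_compactSpace (hG₀c.mul (hκG₀c h)) μ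
  have hcentre : (∫ x, G x * G x ∂μ) - ∫ x, G x * (∫ y, G y ∂(κ h x)) ∂μ =
      (∫ x, G₀ x * G₀ x ∂μ) - ∫ x, G₀ x * (∫ y, G₀ y ∂(κ h x)) ∂μ := by
    rw [← integral_sub hi1 hi2, ← integral_sub hi3 hi4]
    -- pointwise: `G² − Gκ_hG = (G₀² − G₀κ_hG₀) + m (G − κ_h G)`; the last term integrates to `0`
    have e : ∀ x, G x * G x - G x * (∫ y, G y ∂(κ h x)) =
        (G₀ x * G₀ x - G₀ x * (∫ y, G₀ y ∂(κ h x))) + m * (G₀ x - ∫ y, G₀ y ∂(κ h x)) := by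
      intro x; rw [hκG₀ h x]; simp only [hG₀]; ring
    simp_rw [e]
    have hi5 : Integrable (fun x => m * (G₀ x - ∫ y, G₀ y ∂(κ h x))) μ :=
      (integrable_of_continuous_of_compactSpace (hG₀c.sub (hκG₀c h)) μ).const_mul m
    have hi34 : Integrable (fun x => G₀ x * G₀ x - G₀ x * (∫ y, G₀ y ∂(κ h x))) μ := hi3.sub hi4
    rw [integral_add hi34 hi5, integral_const_mul,
      integral_sub (integrable_of_continuous_of_compactSpace hG₀c μ) (integrable_of_continuous_of_compactSpace (hκG₀c h) μ),
      hG₀0, hκG₀0 h, sub_self, mul_zero, add_zero, integral_sub hi3 hi4]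
  -- (2) `∫ G₀ κ_h G₀ = ∫ (κ_{h/2} G − m)² ≤ e^{−λh} Var(G)` and `∫ G₀² = Var(G)`
  have hVar : ∫ x, G₀ x * G₀ x ∂μ = ∫ x, (G x - m) ^ 2 ∂μ :=
    integral_congr_ae (Eventually.of_forall fun x => by simp only [hG₀]; ring)
  have hmid : ∫ x, G₀ x * (∫ y, G₀ y ∂(κ h x)) ∂μ = ∫ x, ((∫ y, G y ∂(κ (h / 2) x)) - m) ^ 2 ∂μ := by
    have e : h = h / 2 + h / 2 := (add_halves h).symm
    rw [e, integral_mul_transition_self_eq_sq L β' κ hreal (h / 2) hG₀c, ← e]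
    exact integral_congr_ae (Eventually.of_forall fun x => by simp only [hκG₀ (h / 2) x])
  have hdec := hdecay G hG (h / 2)
  have e2 : Real.exp (-2 * lam * ((h / 2 : ℝ≥0) : ℝ)) = Real.exp (-lam * h) := by
    congr 1; push_cast; ring
  rw [e2] at hdec
  -- assemble
  have hhR : (0 : ℝ) < h := by exact_mod_cast hh
  rw [hcentre, hVar, hmid, div_eq_inv_mul, mul_assoc]
  refine mul_le_mul_of_nonneg_left ?_ (inv_nonneg.2 hhR.le)
  have hV : 0 ≤ ∫ x, (G x - m) ^ 2 ∂μ := integral_nonneg fun x => sq_nonneg _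
  nlinarith [hdec, hV]

/-- ★ **At fixed cut-off, the best Poincaré constant of the semigroup Dirichlet form on `C(X)` IS the `L²(μ_{β'})` decay rate**:
for every realising kernel family and every `λ`, the finitary semigroup-form Poincaré inequality with constant `1/λ` on continuous
observables is EQUIVALENT to `∫ (κ_t G − μG)² dμ ≤ e^{−2λt} Var_μ(G)` for all continuous `G` and all `t`.
(`⇒`: `integral_sq_transition_sub_le_exp_of_semigroupPoincare`; `⇐`: `semigroupPoincare_of_integral_sq_transition_sub_le_exp` and
`(1 − e^{−λh})/h → λ` as `h → 0⁺`.) [cite: BakryGentilLedoux2014, Thm 4.2.5 with Remark 4.3.3] -/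
theorem semigroupPoincare_iff_integral_sq_transition_sub_le_exp (L : ℕ) [NeZero L] (β' : ℝ)
    (κ : ℝ≥0 → Kernel (GaugeConfig 3 L (Matrix.specialUnitaryGroup (Fin 2) ℂ))
      (GaugeConfig 3 L (Matrix.specialUnitaryGroup (Fin 2) ℂ))) [∀ t, IsMarkovKernel (κ t)]
    (hreal : ∀ (t : ℝ≥0) (x : GaugeConfig 3 L (Matrix.specialUnitaryGroup (Fin 2) ℂ))
        (Ω : Type) [MeasurableSpace Ω] (P : Measure Ω) [IsProbabilityMeasure P]
        (W : ℝ≥0 → Ω → (Edge 3 L × NoiseIdx 2 → ℝ)) (hW : IsFlatBrownian W P)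
        (U : ℝ≥0 → Ω → GaugeConfig 3 L (Matrix.specialUnitaryGroup (Fin 2) ℂ)),
        (∀ ω, U 0 ω = x) →
        (latticeLangevinDynamics (fundamentalLatticeRep 2) β').IsSolution (fundamentalRep (Fin 2))
          hW.natFiltration P W U →
        κ t x = P.map (U t))
    (lam : ℝ) :
    (∀ G : GaugeConfig 3 L (Matrix.specialUnitaryGroup (Fin 2) ℂ) → ℝ, Continuous G → ∀ η : ℝ, 0 < η →
      ∃ h : ℝ≥0, 0 < h ∧
        (lam - η) * ∫ x, (G x - ∫ z, G z ∂(wilsonMeasure (d := 3) (L := L) (fundamentalRep (Fin 2)) β')) ^ 2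
            ∂(wilsonMeasure (d := 3) (L := L) (fundamentalRep (Fin 2)) β') ≤
          (h : ℝ)⁻¹ * ((∫ x, G x * G x ∂(wilsonMeasure (d := 3) (L := L) (fundamentalRep (Fin 2)) β')) -
            ∫ x, G x * (∫ y, G y ∂(κ h x)) ∂(wilsonMeasure (d := 3) (L := L) (fundamentalRep (Fin 2)) β'))) ↔
    (∀ G : GaugeConfig 3 L (Matrix.specialUnitaryGroup (Fin 2) ℂ) → ℝ, Continuous G → ∀ t : ℝ≥0,
      ∫ x, ((∫ y, G y ∂(κ t x)) - ∫ z, G z ∂(wilsonMeasure (d := 3) (L := L) (fundamentalRep (Fin 2)) β')) ^ 2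
          ∂(wilsonMeasure (d := 3) (L := L) (fundamentalRep (Fin 2)) β') ≤
        Real.exp (-2 * lam * t) *
          ∫ x, (G x - ∫ z, G z ∂(wilsonMeasure (d := 3) (L := L) (fundamentalRep (Fin 2)) β')) ^ 2
            ∂(wilsonMeasure (d := 3) (L := L) (fundamentalRep (Fin 2)) β')) := by
  constructor
  · intro hP G hG t
    exact integral_sq_transition_sub_le_exp_of_semigroupPoincare L β' κ hreal hP hG t
  · intro hdecay G hG η hη
    set V : ℝ := ∫ x, (G x - ∫ z, G z ∂(wilsonMeasure (d := 3) (L := L) (fundamentalRep (Fin 2)) β')) ^ 2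
      ∂(wilsonMeasure (d := 3) (L := L) (fundamentalRep (Fin 2)) β') with hV
    have hV0 : 0 ≤ V := integral_nonneg fun x => sq_nonneg _
    -- a scale `h > 0` with `(1 − e^{−λh})/h ≥ λ − η`: the slope of `u ↦ 1 − e^{−λu}` at `0` is `λ`
    have hderiv : HasDerivAt (fun u : ℝ => 1 - Real.exp (-lam * u)) lam 0 := by
      have h1 : HasDerivAt (fun u : ℝ => -lam * u) (-lam) 0 := by
        simpa using (hasDerivAt_id (0 : ℝ)).const_mul (-lam)
      have h2 : HasDerivAt (fun u : ℝ => Real.exp (-lam * u)) (Real.exp (-lam * 0) * (-lam)) 0 := h1.exp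
      have h3 := (hasDerivAt_const (0 : ℝ) (1 : ℝ)).sub h2
      simp only [mul_zero, Real.exp_zero, one_mul, zero_sub, neg_neg] at h3
      exact h3
    have hslope : Tendsto (fun u : ℝ => (1 - Real.exp (-lam * u)) / u) (𝓝[>] 0) (𝓝 lam) := by
      have h := hderiv.tendsto_slope_zero_right
      refine h.congr' ?_
      filter_upwards [self_mem_nhdsWithin] with u hu
      simp only [zero_add, mul_zero, Real.exp_zero, sub_self, sub_zero, smul_eq_mul]
      rw [div_eq_inv_mul]
    have hev : ∀ᶠ u : ℝ in 𝓝[>] 0, lam - η < (1 - Real.exp (-lam * u)) / u :=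
      hslope.eventually (eventually_gt_nhds (by linarith))
    obtain ⟨u, hu, hupos⟩ := (hev.and self_mem_nhdsWithin).exists
    have hupos' : (0 : ℝ) < u := hupos
    refine ⟨u.toNNReal, by exact_mod_cast Real.toNNReal_pos.2 hupos', ?_⟩
    have hcoe : ((u.toNNReal : ℝ≥0) : ℝ) = u := Real.coe_toNNReal _ hupos'.le
    have hmain := semigroupPoincare_of_integral_sq_transition_sub_le_exp L β' κ hreal hdecay hG
      (h := u.toNNReal) (Real.toNNReal_pos.2 hupos')
    rw [hcoe] at hmain ⊢
    calc (lam - η) * V ≤ (1 - Real.exp (-lam * u)) / u * V := mul_le_mul_of_nonneg_right hu.le hV0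
      _ ≤ _ := hmain

/-- ★ **The semigroup-form Poincaré inequality holds at every cut-off** with the `L²` rate `c = c(L, β') > 0` of
`wilson_spectralGap` (Doeblin/Harris ⇒ `L²` gap with constant one ⇒ Poincaré for the semigroup Dirichlet form at every scale):
`(1 − e^{−ch})/h · Var_μ(G) ≤ h⁻¹(∫ G² dμ − ∫ G κ_h G dμ)` for every realising kernel family, every continuous `G` and every `h > 0`.
[cite: RobertsRosenthal1997, Theorem 2.1] -/
theorem wilson_semigroupPoincare (L : ℕ) [NeZero L] (β' : ℝ) :
    ∃ c : ℝ, 0 < c ∧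
      ∀ (κ : ℝ≥0 → Kernel (GaugeConfig 3 L (Matrix.specialUnitaryGroup (Fin 2) ℂ))
          (GaugeConfig 3 L (Matrix.specialUnitaryGroup (Fin 2) ℂ))) [∀ t, IsMarkovKernel (κ t)],
        (∀ (t : ℝ≥0) (x : GaugeConfig 3 L (Matrix.specialUnitaryGroup (Fin 2) ℂ))
          (Ω : Type) [MeasurableSpace Ω] (P : Measure Ω) [IsProbabilityMeasure P]
          (W : ℝ≥0 → Ω → (Edge 3 L × NoiseIdx 2 → ℝ)) (hW : IsFlatBrownian W P)
          (U : ℝ≥0 → Ω → GaugeConfig 3 L (Matrix.specialUnitaryGroup (Fin 2) ℂ)),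
          (∀ ω, U 0 ω = x) →
          (latticeLangevinDynamics (fundamentalLatticeRep 2) β').IsSolution (fundamentalRep (Fin 2))
            hW.natFiltration P W U →
          κ t x = P.map (U t)) →
        ∀ (G : GaugeConfig 3 L (Matrix.specialUnitaryGroup (Fin 2) ℂ) → ℝ), Continuous G → ∀ h : ℝ≥0, 0 < h →
          (1 - Real.exp (-c * h)) / h *
              ∫ x, (G x - ∫ z, G z ∂(wilsonMeasure (d := 3) (L := L) (fundamentalRep (Fin 2)) β')) ^ 2
                ∂(wilsonMeasure (d := 3) (L := L) (fundamentalRep (Fin 2)) β') ≤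
            (h : ℝ)⁻¹ * ((∫ x, G x * G x ∂(wilsonMeasure (d := 3) (L := L) (fundamentalRep (Fin 2)) β')) -
              ∫ x, G x * (∫ y, G y ∂(κ h x)) ∂(wilsonMeasure (d := 3) (L := L) (fundamentalRep (Fin 2)) β')) := by
  obtain ⟨c, hc, hgap⟩ := wilson_spectralGap L β'
  refine ⟨c, hc, fun κ _ hreal G hG h hh => ?_⟩
  exact semigroupPoincare_of_integral_sq_transition_sub_le_exp L β' κ hreal
    (fun G' hG' t => (hgap κ hreal G' hG' t).2.2) hG hh

end Summit.QuantumFields.YangMills.Theorems.ColdStartUniversality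

end
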